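import Mathlib
import Literature.AlgebraicGeometry.Resolution.WeightedResolutionDatum
import Summits.ResolutionOfSingularities.ResolutionOfSingularities.Theorems.WeightedInvariantRegularSubschemeCentre

/-!
# The point blow-up is a symmetric admissible move at every singular position

[OURS · L1 W4.3 · crux `WeightedConstruction` stmt-ResolutionOfSingularities-0571; refuter res-L1-w43-tri-2, TRIAGE v8 O-v8.6]
AI-written; weaker than expert review.  NOT a statement of any manuscript.

Small-model / non-vacuity facts for the kill templates of the door key (`CanonicalGameClause`,
`LocalWeightedDropEFT3/4S`): the (o27) families (`…/HypersurfaceCentreConstruction/Negative/CanonicalGameFalseOfMinimalMoves.lean`)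
and the SYMMETRY CUT (`…/Negative/CanonicalGameFalseOfSymmetricMinimalMoves.lean`, p515223) ask every member `(S, f)` of a
closed family to answer each admissible presented move — in the cut, only the moves whose centre and filtration are stable under
every ring automorphism of `S`.  This file records that the move set to be answered is NEVER EMPTY: the plain point blow-up
`(P = 𝔪, u = any system of generators of 𝔪, w = (1, …, 1))` satisfies every premise, including the symmetry premise, at
every position with `f ∈ 𝔪²`.  Consequently no closed (symmetric) family can be built from vacuity: each member must have a
singular point-blow-up successor inside the family (up to essentially smooth pull-back and a unit).

Contents (all `[folklore]`, sorry-free):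
* `weightedMonomialIdeal_const_one_eq_maximalIdeal_pow` — `𝒥_m(u; 1,…,1) = 𝔪^m` (by name from
  `Theorems.weightedMonomialIdeal_one_eq_pow`, [cite: Wlodarczyk2022, Lemma 4.6.1]);
* `map_ringEquiv_weightedMonomialIdeal_const_one` — that filtration is stable under every ring automorphism of `S`;
* `centre_const_one_eq_maximalIdeal` — the presented centre `(u_j : w_j > 0)` is `𝔪`;
* `admissible_pointBlowup` — (adm): `f ∈ 𝔪_Q²` at every prime `Q ⊇ 𝔪`;
* `pointBlowup_symmetricMovePremises` — the premises of the symmetry cut's `hclosed`, bundled, for `(𝔪, n, u, 1ⁿ)`.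
-/

set_option linter.dupNamespace false
set_option autoImplicit false

open IsLocalRing
open Literature.AlgebraicGeometry.Resolution

namespace Summit.ResolutionOfSingularities.ResolutionOfSingularities.Theorems.WeightedConstruction.Negative.PointBlowupSymmetricMove

variable {S : Type} [CommRing S] [IsLocalRing S] {n : ℕ}

/-- With all weights `1` the weighted monomial filtration of a system of generators of `𝔪` is the `𝔪`-adic one:
`𝒥_m(u; 1, …, 1) = 𝔪^m`. [cite: Wlodarczyk2022, Lemma 4.6.1] -/
theorem weightedMonomialIdeal_const_one_eq_maximalIdeal_pow (u : Fin n → S)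
    (hspan : Ideal.span (Set.range u) = maximalIdeal S) (m : ℕ) :
    weightedMonomialIdeal u (fun _ => 1) m = maximalIdeal S ^ m := by
  rw [Theorems.weightedMonomialIdeal_one_eq_pow, hspan]

/-- The `𝔪`-adic filtration (= the point blow-up's filtration) is stable under every ring automorphism. [folklore] -/
theorem map_ringEquiv_weightedMonomialIdeal_const_one (u : Fin n → S)
    (hspan : Ideal.span (Set.range u) = maximalIdeal S) (σ : S ≃+* S) (m : ℕ) :
    (weightedMonomialIdeal u (fun _ => 1) m).map σ = weightedMonomialIdeal u (fun _ => 1) m := by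
  rw [weightedMonomialIdeal_const_one_eq_maximalIdeal_pow u hspan, Ideal.map_pow, map_ringEquiv_maximalIdeal]

/-- The presented centre of the point blow-up, `(u_j : 0 < w_j)` with `w = 1ⁿ`, is `𝔪`. [folklore] -/
theorem centre_const_one_eq_maximalIdeal (u : Fin n → S) (hspan : Ideal.span (Set.range u) = maximalIdeal S) :
    Ideal.span {x | ∃ j : Fin n, 0 < (fun _ : Fin n => (1 : ℕ)) j ∧ x = u j} = maximalIdeal S := by
  have hset : {x | ∃ j : Fin n, 0 < (fun _ : Fin n => (1 : ℕ)) j ∧ x = u j} = Set.range u := by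
    ext x
    simp only [Nat.lt_one_iff, true_and, Set.mem_setOf_eq, Set.mem_range]
    constructor
    · rintro ⟨j, rfl⟩
      exact ⟨j, rfl⟩
    · rintro ⟨j, rfl⟩
      exact ⟨j, rfl⟩
  rw [hset, hspan]

/-- (adm) for the point blow-up: if `f ∈ 𝔪²` then `f ∈ 𝔪_Q²` at every prime `Q ⊇ 𝔪` (there is only `Q = 𝔪`). [folklore] -/
theorem admissible_pointBlowup {f : S} (hf2 : f ∈ maximalIdeal S ^ 2) (Q : Ideal S) [Q.IsPrime]
    (hQ : maximalIdeal S ≤ Q) :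
    algebraMap S (Localization.AtPrime Q) f ∈ maximalIdeal (Localization.AtPrime Q) ^ 2 := by
  have hQeq : maximalIdeal S = Q := (maximalIdeal.isMaximal S).eq_of_le Ideal.IsPrime.ne_top' hQ
  have hfQ : f ∈ Q ^ 2 := hQeq ▸ hf2
  rw [← IsLocalization.AtPrime.map_eq_maximalIdeal Q (Localization.AtPrime Q), ← Ideal.map_pow]
  exact Ideal.mem_map_of_mem _ hfQ

/-- The residue field is a regular local ring (dimension `0`). [folklore] -/
theorem isRegularLocalRing_quotient_maximalIdeal : IsRegularLocalRing (S ⧸ maximalIdeal S) :=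
  letI : Field (S ⧸ maximalIdeal S) := Ideal.Quotient.field (maximalIdeal S)
  inferInstance

/-- **The point blow-up satisfies every premise of the symmetry cut's move clause.**  For a local ring `S`, a system of
generators `u` of `𝔪` indexed by `Fin n` with `n > 0`, and `f ∈ 𝔪²`: the centre `𝔪` is prime with regular quotient, contains
`f`, is presented by `(u, 1ⁿ)`, the move is admissible, and centre and filtration are stable under EVERY ring automorphism
`σ` of `S` (a fortiori under those with `σ f = v·f`).  This is the antecedent list of `hclosed` in
`HypersurfaceCentreConstruction.Negative.canonicalGameClause_false_of_closedSymmetricMinimalFamily` at `P = 𝔪`, `w = 1ⁿ`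
(the `spanFinrank` clause is a hypothesis on `u`, passed through). [folklore] -/
theorem pointBlowup_symmetricMovePremises (u : Fin n → S) (hspan : Ideal.span (Set.range u) = maximalIdeal S)
    (hrank : (maximalIdeal S).spanFinrank = n) (hn : 0 < n) {f : S} (hf2 : f ∈ maximalIdeal S ^ 2) :
    (maximalIdeal S).IsPrime ∧ IsRegularLocalRing (S ⧸ maximalIdeal S) ∧ f ∈ maximalIdeal S ∧
      Ideal.span (Set.range u) = maximalIdeal S ∧ (maximalIdeal S).spanFinrank = n ∧
      (∃ j : Fin n, 0 < (fun _ : Fin n => (1 : ℕ)) j) ∧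
      Ideal.span {x | ∃ j : Fin n, 0 < (fun _ : Fin n => (1 : ℕ)) j ∧ x = u j} = maximalIdeal S ∧
      (∀ (Q : Ideal S) [Q.IsPrime], maximalIdeal S ≤ Q →
        algebraMap S (Localization.AtPrime Q) f ∈ maximalIdeal (Localization.AtPrime Q) ^ 2) ∧
      (∀ (σ : S ≃+* S) (v : S), IsUnit v → σ f = v * f →
        (maximalIdeal S).map σ = maximalIdeal S ∧
          ∀ m : ℕ, (weightedMonomialIdeal u (fun _ => 1) m).map σ = weightedMonomialIdeal u (fun _ => 1) m) := by
  refine ⟨(maximalIdeal.isMaximal S).isPrime, isRegularLocalRing_quotient_maximalIdeal,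
    Ideal.pow_le_self two_ne_zero hf2, hspan, hrank, ⟨⟨0, hn⟩, Nat.one_pos⟩,
    centre_const_one_eq_maximalIdeal u hspan, fun Q _ hQ => admissible_pointBlowup hf2 Q hQ, fun σ _ _ _ => ?_⟩
  exact ⟨map_ringEquiv_maximalIdeal σ, map_ringEquiv_weightedMonomialIdeal_const_one u hspan σ⟩

end Summit.ResolutionOfSingularities.ResolutionOfSingularities.Theorems.WeightedConstruction.Negative.PointBlowupSymmetricMove
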